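import Summits.ResolutionOfSingularities.ResolutionOfSingularities.Theorems.HomologicalConductorNoZenoTransversal
import Mathlib.RingTheory.DiscreteValuationRing.TFAE
import HarnessLib

/-!
# Crux `NoZenoR` (stmt-ResolutionOfSingularities-19943), slot 5 (B1), (P3) part 2: an exceptional curve of a
# resolution of a RATIONAL surface singularity is REGULAR at every point where it meets another exceptional curve

OURS (cell res-hironaka, crux chain W4.4, seat res-D-pv-045 gen 8; object (P3) of res-L0-w44-plan-1 DESK WORD 19 —
(T3), the regularity input of the (A4) loop and of the `h⁰`-equality for strict transforms); nothing here is a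
statement of the manuscript under review (Hironaka 2017); AI-written, weaker than expert review.  SUPPORT-level,
counted 0.  Def-free.  ONE fact binder `(h131d : Lipman1969_13_1_d_rat.{0})` (through part 1).

* §1 (fact-free, any integral locally Noetherian scheme): **an effective Cartier divisor of ORDER ONE at a
  codimension-one point `y` forces `𝒪_{Y,y}` to be a discrete valuation ring** — its local equation `t` has
  `length(𝒪/(t)) = 1`, so `(t) = 𝔪` is principal (`IsDiscreteValuationRing.TFAE`); hence regular.
* §2 (T3): for `π` a resolution of a rational two-dimensional normal local domain and `η_a ≠ η_b` exceptional with a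
  common point `z`, the local ring of the integral curve `E_a = ClosedSubvariety.ofPoint X η_a` at its point over `z`
  is REGULAR — part 1's (T2′) `ordAt_pullbackAvoiding_eq_one` (the restricted divisor `[E_b]|_{E_a}` has order one
  at `z`) fed into §1.

References: J. Lipman, *Rational singularities …*, Publ. Math. IHÉS 36 (1969), §10, Prop. (13.1) [`Lipman1969`];
J.-P. Serre, *Local Algebra*, Ch. I §2 (DVR criteria) [`Matsumura1987`, Thm. 11.2].
-/

noncomputable section

-- single-problem summit: the doubled namespace component `ResolutionOfSingularities` is forced
set_option linter.dupNamespace false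

namespace Summit.ResolutionOfSingularities.ResolutionOfSingularities.Theorems.NoZeno.ExcCount

open CategoryTheory AlgebraicGeometry TopologicalSpace IsLocalRing Order
open Literature.AlgebraicGeometry.Resolution Literature.AlgebraicGeometry.Motives
open Literature.AlgebraicGeometry.Motives.RatFn

universe u

/-! ## §1 Order one at a codimension-one point ⇒ discrete valuation ring -/

section OrderOne

variable {Y : Scheme.{u}} [IsIntegral Y] [IsLocallyNoetherian Y]

/-- **`ord_y(t) = 1` means `(t) = 𝔪_y`**: for a non-zero germ `t ∈ 𝒪_{Y,y}` at a codimension-one point with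
`Scheme.ord (t) y = 1`, the length of `𝒪_{Y,y}/(t)` is one, so `(t)` is the maximal ideal. [folklore] -/
theorem span_singleton_eq_maximalIdeal_of_ord_eq_one {y : Y} (hy : coheight y = 1) {t : Y.presheaf.stalk y}
    (ht : t ≠ 0) (h1 : Scheme.ord (toFunctionField y t) y = 1) :
    Ideal.span {t} = maximalIdeal (Y.presheaf.stalk y) := by
  haveI : Ring.KrullDimLE 1 (Y.presheaf.stalk y) := krullDimLE_of_coheight_le hy.le
  have ht' : t ∈ nonZeroDivisors (Y.presheaf.stalk y) := mem_nonZeroDivisors_of_ne_zero ht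
  have h0 : toFunctionField y t ≠ 0 := (map_ne_zero_iff _ (toFunctionField_injective y)).mpr ht
  -- `Ring.ord t = n` for some `n : ℕ`, and `Scheme.ord = n`
  obtain ⟨n, hn⟩ := ENat.ne_top_iff_exists.mp (Ring.ord_ne_top ht')
  have key : Scheme.ord (toFunctionField y t) y = n := by
    rw [Scheme.ord_eq_iff hy h0]
    change Ring.ordFrac (Y.presheaf.stalk y) (algebraMap _ Y.functionField t) = _
    rw [Ring.ordFrac_eq_ord _ ht, Ring.ordMonoidWithZeroHom_eq_coe _ ht' hn.symm]
  rw [key] at h1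
  have hn1 : n = 1 := by exact_mod_cast h1
  subst hn1
  -- length one quotient ⇒ `(t)` is a coatom, i.e. maximal
  have hlen : Module.length (Y.presheaf.stalk y) (Y.presheaf.stalk y ⧸ Ideal.span {t}) = 1 := by
    change Ring.ord (Y.presheaf.stalk y) t = 1
    rw [← hn]
    rfl
  have hsimple : IsSimpleModule (Y.presheaf.stalk y) (Y.presheaf.stalk y ⧸ Ideal.span {t}) :=
    Module.length_eq_one_iff.mp hlen
  have hcoatom : IsCoatom (Ideal.span ({t} : Set (Y.presheaf.stalk y))) := isSimpleModule_iff_isCoatom.mp hsimple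
  exact IsLocalRing.eq_maximalIdeal (Ideal.isMaximal_def.mpr hcoatom)

/-- **An effective Cartier divisor of order one at a codimension-one point `y` makes `𝒪_{Y,y}` a discrete valuation
ring** (the maximal ideal is generated by the local equation). [cite: Matsumura1987, Thm. 11.2] -/
theorem isDiscreteValuationRing_stalk_of_ordAt_eq_one {D : CartierDivisor Y} (hD : D.IsEffective) {y : Y}
    (hy : coheight y = 1) (h1 : D.ordAt y = 1) : IsDiscreteValuationRing (Y.presheaf.stalk y) := by
  obtain ⟨i, hi⟩ := D.covers y
  obtain ⟨t, ht⟩ := hD i y hi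
  have ht0 : t ≠ 0 := fun h => D.f_ne_zero i (by rw [← ht, h, map_zero])
  rw [D.ordAt_eq_ord hi, ← ht] at h1
  have hmax := span_singleton_eq_maximalIdeal_of_ord_eq_one hy ht0 h1
  have hnf := not_isField_stalk_of_coheight_eq_one (X := Y) hy
  have hP : (maximalIdeal (Y.presheaf.stalk y)).IsPrincipal := ⟨⟨t, hmax.symm⟩⟩
  exact ((IsDiscreteValuationRing.TFAE (Y.presheaf.stalk y) hnf).out 0 4).mpr hP

/-- Regularity form: such a local ring is a regular local ring. [cite: Matsumura1987, Thm. 11.2] -/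
theorem isRegularLocalRing_stalk_of_ordAt_eq_one {D : CartierDivisor Y} (hD : D.IsEffective) {y : Y}
    (hy : coheight y = 1) (h1 : D.ordAt y = 1) : IsRegularLocalRing (Y.presheaf.stalk y) := by
  haveI := isDiscreteValuationRing_stalk_of_ordAt_eq_one hD hy h1
  infer_instance

end OrderOne

/-! ## §2 (T3) Exceptional curves of a rational resolution are regular at their common points -/

section Rational

variable {S : Type} [CommRing S] [IsNoetherianRing S] [IsLocalRing S] [IsDomain S] [IsIntegrallyClosed S]
  {X : Scheme.{0}} [IsIntegral X] [IsLocallyNoetherian X] {π : X ⟶ Spec (.of S)}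

/-- **(T3) AN EXCEPTIONAL CURVE IS REGULAR WHERE IT MEETS ANOTHER ONE.**  For `π` a resolution of a RATIONAL
two-dimensional normal Noetherian local domain, `η_a ≠ η_b` in `excCurvePoints π` and a common point `z`
(`η_a ⤳ z`, `η_b ⤳ z`): the local ring of the integral curve `E_a = ClosedSubvariety.ofPoint X η_a` at its point over
`z` is a regular local ring (indeed a discrete valuation ring whose maximal ideal is generated by the local equation
of `E_b`).  Conditional on `Lipman1969_13_1_d_rat`. [cite: Lipman1969, Proposition (13.1) d) (p. 223)] -/
theorem isRegularLocalRing_stalk_ofPoint_of_specializes (h131d : Lipman1969_13_1_d_rat.{0})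
    (hdim : ringKrullDim S = 2) (hS : HasRationalSingularity S) (hπ : IsResolution π)
    {η_a η_b : X} (ha : η_a ∈ excCurvePoints π) (hb : η_b ∈ excCurvePoints π) (hne : η_a ≠ η_b)
    {z : X} (hza : η_a ⤳ z) (hzb : η_b ⤳ z) :
    IsRegularLocalRing ((ClosedSubvariety.ofPoint X η_a).carrier.presheaf.stalk (ClosedSubvariety.ofPointPt η_a hza)) := by
  haveI : IsProper π := hπ.isProper
  have hF : IsEffectiveCartier (primeDivisorIdeal η_b) := isEffectiveCartier_primeDivisorIdeal_of_isRegular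
    hπ.isRegular (IsResolution.coheight_eq_one_of_mem_excCurvePoints hdim hπ hb)
  have hba : ¬ η_b ⤳ η_a := not_specializes_of_mem_excCurvePoints_of_ne π ha hb hne
  have h1 := ordAt_pullbackAvoiding_eq_one h131d hdim hS hπ ha hb hne hza hzb hF
  have hDeff := (CartierDivisor.isEffective_ofIsEffectiveCartier _ hF).pullbackAvoiding
    (ClosedSubvariety.ofPoint X η_a).ι (avoids_ι_genericPoint_ofPoint hba hF)
  -- the point of `E_a` over `z` is a closed point of the curve: codimension one in `E_a`
  obtain ⟨q, hq⟩ := exists_fac_specResidueField π ha.1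
  haveI : IsIntegral (Over.mk q : SchemeOver (ResidueField S)).left :=
    inferInstanceAs (IsIntegral (ClosedSubvariety.ofPoint X η_a).carrier)
  haveI : IsProper (Over.mk q : SchemeOver (ResidueField S)).hom := isProper_of_fac_specResidueField π hq
  have hcoh : coheight (ClosedSubvariety.ofPointPt η_a hza) = 1 :=
    CartierDivisor.coheight_eq_one_of_height_eq_zero (C := (Over.mk q : SchemeOver (ResidueField S)))
      (height_top_ofPoint_eq_one π ha) (height_ofPointPt_eq_zero π ha hza (by rintro rfl; exact hba hzb))
  exact isRegularLocalRing_stalk_of_ordAt_eq_one hDeff hcoh h1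

/-- (T3), DVR form: the local ring of `E_a` at the common point is a discrete valuation ring.
[cite: Lipman1969, Proposition (13.1) d) (p. 223)] -/
theorem isDiscreteValuationRing_stalk_ofPoint_of_specializes (h131d : Lipman1969_13_1_d_rat.{0})
    (hdim : ringKrullDim S = 2) (hS : HasRationalSingularity S) (hπ : IsResolution π)
    {η_a η_b : X} (ha : η_a ∈ excCurvePoints π) (hb : η_b ∈ excCurvePoints π) (hne : η_a ≠ η_b)
    {z : X} (hza : η_a ⤳ z) (hzb : η_b ⤳ z) :
    IsDiscreteValuationRing
      ((ClosedSubvariety.ofPoint X η_a).carrier.presheaf.stalk (ClosedSubvariety.ofPointPt η_a hza)) := by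
  haveI : IsProper π := hπ.isProper
  have hF : IsEffectiveCartier (primeDivisorIdeal η_b) := isEffectiveCartier_primeDivisorIdeal_of_isRegular
    hπ.isRegular (IsResolution.coheight_eq_one_of_mem_excCurvePoints hdim hπ hb)
  have hba : ¬ η_b ⤳ η_a := not_specializes_of_mem_excCurvePoints_of_ne π ha hb hne
  have h1 := ordAt_pullbackAvoiding_eq_one h131d hdim hS hπ ha hb hne hza hzb hF
  have hDeff := (CartierDivisor.isEffective_ofIsEffectiveCartier _ hF).pullbackAvoiding
    (ClosedSubvariety.ofPoint X η_a).ι (avoids_ι_genericPoint_ofPoint hba hF)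
  obtain ⟨q, hq⟩ := exists_fac_specResidueField π ha.1
  haveI : IsIntegral (Over.mk q : SchemeOver (ResidueField S)).left :=
    inferInstanceAs (IsIntegral (ClosedSubvariety.ofPoint X η_a).carrier)
  haveI : IsProper (Over.mk q : SchemeOver (ResidueField S)).hom := isProper_of_fac_specResidueField π hq
  have hcoh : coheight (ClosedSubvariety.ofPointPt η_a hza) = 1 :=
    CartierDivisor.coheight_eq_one_of_height_eq_zero (C := (Over.mk q : SchemeOver (ResidueField S)))
      (height_top_ofPoint_eq_one π ha) (height_ofPointPt_eq_zero π ha hza (by rintro rfl; exact hba hzb))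
  exact isDiscreteValuationRing_stalk_of_ordAt_eq_one hDeff hcoh h1

end Rational

end Summit.ResolutionOfSingularities.ResolutionOfSingularities.Theorems.NoZeno.ExcCount

end
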